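import Summits.BirchSwinnertonDyer.BirchSwinnertonDyer.Theorems.PrintCf2RubinValueTwoEllipticUnitsLocalMeasure
import HarnessLib

/-!
# UNIQUENESS of de Shalit's one-`𝔓` measure: two bounded distributions with `δ_{g_𝔠, N𝔠} μ = i(e(𝔠))` for the twists coincide
# (de Shalit II.4.12, p. 68: "`δ_𝔞` is a non-zero-divisor" — here for ANY single twist with `N𝔠 ≥ 2`)

Cell `bsd-print-cf2`, width seat `bsd-line-cf2c-w4` g10; `--supports` stmt-BirchSwinnertonDyer-24721 (helper, Theses-free). THEOREMS ONLY,
no named facts.  Complement of `PrintCf2RubinValueTwoEllipticUnitsLocalMeasure.lean` (EXISTENCE of `μ` with `δ_{g_𝔠,N𝔠} μ = i(e(𝔠))` for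
every twist `𝔠 ∈ I`): the print (II.4.12) asserts existence AND uniqueness of `μ(𝔣)`.  Uniqueness needs no elliptic input at all: the
twisting operator `δ_{σ,c}` is injective on bounded distributions along any tower as soon as `c` is not a root of unity
(`GroupDistribution.μ_eq_of_twisting_μ_eq`, cf2c-w4 g4), and `c = N𝔠 ≥ 2` is not one in `ℂ₂`.

* `natCast_pow_ne_one` — `(N : ℂ₂)^k ≠ 1` for `N ≥ 2`, `k ≥ 1`;
* ★ `groupDistribution_μ_eq_of_twisting_eq` — **two distributions `μ, μ'` along `rayAdicTower h𝔪 v` (indeed along any tower) whose twists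
  `δ_{g_𝔠, N𝔠}` agree with the same targets for a family of twists containing ONE `𝔠₀` with `N𝔠₀ ≥ 2` agree levelwise** — so the `μ` of
  `exists_groupDistribution_twisting_eq_induce_ellipticUnitsLocal` is unique.

HONEST FRAMING: a two-line consequence of accepted kernel theorems; nothing here closes a crux; BSD is not proved by any of this.

## References
* [deShalit1987] E. de Shalit, *Iwasawa theory of elliptic curves with complex multiplication* (1987), II.4.12 (p. 68–69).
-/

-- the summit namespace `Summit.BirchSwinnertonDyer.BirchSwinnertonDyer` repeats the problem name by design (D-0017)
set_option linter.dupNamespace false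
set_option autoImplicit false

noncomputable section

open Literature.NumberTheory.EllipticCurves Literature.NumberTheory.EllipticCurves.GroupDistribution

namespace Summit.BirchSwinnertonDyer.BirchSwinnertonDyer.Theorems.PrintCf2.EllipticUnitsLocal

/-- `(N : ℂ₂)^k ≠ 1` for `N ≥ 2` and `k ≥ 1` (`N𝔠` is not a root of unity). [cite: deShalit1987, II.4.12 (p. 68)] -/
theorem natCast_pow_ne_one {N : ℕ} (hN : 2 ≤ N) (k : ℕ) (hk : 0 < k) : ((N : ℂ_[2]) ^ k) ≠ 1 := by
  rw [← Nat.cast_pow, ← Nat.cast_one, Ne, Nat.cast_inj]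
  have h : 2 ≤ N ^ k := le_trans hN (Nat.le_self_pow (Nat.pos_iff_ne_zero.mp hk) N)
  omega

/-- ★ **UNIQUENESS of the one-`𝔓` measure** (de Shalit II.4.12: `δ_𝔞` is a non-zero-divisor): along any tower `𝒰` of any group `G`,
two `ℂ₂`-valued bounded distributions `μ, μ'` whose twists `δ_{g_𝔠, N𝔠}` hit the same targets `F 𝔠` for a family of twists `𝔠 ∈ I`
containing one `𝔠₀` with `N𝔠₀ ≥ 2` agree levelwise.  With `F 𝔠 := i(e(𝔠))` this is the uniqueness half of II.4.12 for the `μ` of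
`exists_groupDistribution_twisting_eq_induce_ellipticUnitsLocal`. [cite: deShalit1987, II.4.12 (p. 68–69)] -/
theorem groupDistribution_μ_eq_of_twisting_eq {G : Type*} [Group G] {𝒰 : SubgroupTower G} [∀ n, (𝒰.U n).Normal]
    {I : Type*} (g : I → G) (Nm : I → ℕ) (F : ∀ (_ : I) (n : ℕ), G ⧸ 𝒰.U n → ℂ_[2])
    (μ μ' : GroupDistribution 𝒰 ℂ_[2])
    (hμ : ∀ (c : I) (n : ℕ) (b : G ⧸ 𝒰.U n), (twisting (g c) (Nm c : ℂ_[2]) μ).μ n b = F c n b)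
    (hμ' : ∀ (c : I) (n : ℕ) (b : G ⧸ 𝒰.U n), (twisting (g c) (Nm c : ℂ_[2]) μ').μ n b = F c n b)
    (c₀ : I) (hc₀ : 2 ≤ Nm c₀) (n : ℕ) (b : G ⧸ 𝒰.U n) : μ.μ n b = μ'.μ n b :=
  μ_eq_of_twisting_μ_eq (g c₀) (natCast_pow_ne_one hc₀) μ μ' (fun m b' ↦ by rw [hμ c₀, hμ' c₀]) n b

end Summit.BirchSwinnertonDyer.BirchSwinnertonDyer.Theorems.PrintCf2.EllipticUnitsLocal

end
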